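import Summits.ResolutionOfSingularities.ResolutionOfSingularities.Theorems.HilbertSamuelEliminationCampaignW42RidgeConfinementHypersurface
import Literature.AlgebraicGeometry.Resolution.RegularCentreBlowupOrder
import HarnessLib

/-!
# [OURS · L1 W4.2] Ridge confinement of near points for hypersurfaces — LOCAL RINGS: an arbitrary local base and an
# arbitrary quasi-regular centre (campaign s42 of cell res-hironaka, LADDER-RESOLUTION rung L; hypersurface instance of
# the informal crux `RidgeConfinement`, stmt-ResolutionOfSingularities-17845, route HilbertSamuelElimination;
# `--supports`, NOT a closing file; companion of `…CampaignW42RidgeConfinementHypersurface.lean`)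

HONEST FRAMING. Everything below is OURS (campaign mathematics of slot W4.2 «replace the directrix by Giraud's RIDGE in
CJS Thm. 3.14», prover res-L1-s42-pv-1) and commutative algebra over the TREE's own chart algebra of a blowing up
(`BlowupChartRsop.lean` / `RegularCentreBlowupOrder.lean`: `chartRing`, `chartBase`, `chartGen`,
`exists_chartResidueMap`). NOTHING here is a statement of H. Hironaka's manuscript [Hironaka2017]; nothing here asserts
that any statement of that manuscript holds or fails. AI review is weaker than expert review.

## Setting (the tree's, [CoP1] Prop. 4.2 chart form) and what is proved

`(R, 𝔪, k)` a local ring, `c = (c_1, …, c_k)` a quasi-regular sequence in `𝔪` (the centre `D = V(P)`, `P = (c)`; for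
`R` regular and `R/P` regular this is an arbitrary permissible centre through the closed point), `j` a chart:
`B_j = chartRing c j = R[P/c_j]`, `φ = chartBase c j : R → B_j`, `e_l = chartGen c j l = c_l/c_j` (`e_j = 1`).
A HYPERSURFACE through `D` with multiplicity `μ` along it: `f = F(c)` for a form `F ∈ R[T_1, …, T_k]` of degree `μ`;
its weak (= strict, for a hypersurface) transform on the chart is `F(e)` (`φ(f) = φ(c_j)^μ F(e)`, tree
`reesChartBase_eval_eq_pow_mul_eval₂`), and `F̄ = F mod 𝔪 ∈ k[T]` is the initial form `in_x f` read on the normal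
space `N_x = T_x(Z)/T_x(D) = Spec k[T_1, …, T_k]` of the centre (non-zero iff `ord_x f = μ`, the equimultiple = normally
flat situation; tree `map_residue_ne_zero_of_eval_not_mem_pow_succ`). A point `x'` of the chart over the closed
point `x`, with values in a field `κ`: a ring map `π : B_j → κ` killing `φ(𝔪)`; its direction in
`π⁻¹(x) = ℙ(N_x)` is `v = (π e_l)_l` (`v_j = 1`). NEAR: `ord_{x'} F(e) ≥ μ`, typed
`∃ s, π s ≠ 0 ∧ s · F(e) ∈ (ker π)^μ`.

* **`shift_map_eq_of_near_chart`** — at a near point, the form `F̄ ⊗_k κ ∈ κ[T_1, …, T_k]` is invariant under the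
  translation by `v`; **`exists_form_eq_aeval_of_near_chart`** — indeed `F̄ ⊗ κ = G(T_l − (π e_l)·T_j : l ≠ j)` for a
  form `G` of degree `μ` (the near point lies in the projectivised DIRECTRIX of the base-changed cone `V(F̄) ⊗_k κ`);
  **`chartGen_mem_ridge_of_near`** — `v ∈ ridge κ (Ideal.span {F̄})`, Giraud's ridge of the cone `V(F̄) ⊆ N_x`
  (tree `Resolution.ridge`), for the `k`-algebra structure `k = R/𝔪 → κ` induced by `π ∘ φ`: **the near point lies in
  `ℙ(F(C_x X)/T_x D)`**, in EVERY characteristic and for EVERY residue field extension — the chart-algebra form of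
  Giraud 1975 Cor. 2.4 / CJS 2020 Rem. 18.29 for hypersurfaces, one `exists_chartResidueMap` away from the tree's stalks
  of a blowing up (`RegularCentreBlowupOrder.lean` uses the same chart data for
  `IsBlowup.not_stalkIdeal_controlledTransform_le_pow_of_mem`).

Proof: reduce modulo `𝔪 B_j` with the tree's `ρ : B_j ↠ k[T_l : l ≠ j]` (`ρ(F(e)) = F̄(T_j := 1)`), factor `π` through
`ρ`, and apply the polynomial structure theorem `exists_form_eq_aeval_of_dehomog_mem_pow` of the companion file over
the residue field `k` with the whole variable set as centre directions.

References (orientation only): V. Cossart, O. Piltant, J. Algebra 320 (2008), proof of Prop. 4.2, (10)–(11); J. Giraud,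
Ann. Sci. ÉNS (4) 8 (1975) §1.5, Cor. 2.4; V. Cossart, U. Jannsen, S. Saito, LNM 2270 (2020), Thm. 3.14, Rem. 18.29.
-/

noncomputable section

-- single-conjunct summit: the doubled namespace component `ResolutionOfSingularities` is mandated
set_option linter.dupNamespace false

open MvPolynomial IsLocalRing
open Literature.AlgebraicGeometry.Resolution Literature.RingTheory.MvPolynomial

namespace Summit.ResolutionOfSingularities.ResolutionOfSingularities.Theorems

namespace CampaignW42

universe u v w

section Univ

variable (R : Type u) [CommRing R] {σ : Type v} [DecidableEq σ] (j : σ)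

/-- With every variable a centre direction, the fibre restriction (which then only kills `X_j`) fixes every
dehomogenised polynomial. [folklore] -/
theorem fibreRestrict_univ_dehomog (p : MvPolynomial σ R) :
    fibreRestrict R Set.univ j (dehomog R j p) = dehomog R j p := by
  have h : (fibreRestrict R Set.univ j).comp (dehomog R j) = dehomog R j := by
    refine MvPolynomial.algHom_ext fun i => ?_
    rw [AlgHom.comp_apply]
    by_cases hi : i = j
    · subst hi
      rw [dehomog_X_self, map_one]
    · rw [dehomog_X_of_ne R j hi, fibreRestrict_X_of_mem_of_ne R Set.univ j (Set.mem_univ i) hi]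
  exact AlgHom.congr_fun h p

end Univ

section LocalRing

variable {R : Type u} [CommRing R] [IsLocalRing R] {k : ℕ} (c : Fin k → R) (j : Fin k)

/-- **STRUCTURE THEOREM AT A NEAR POINT, chart of a blowing up of a local ring along a quasi-regular centre.** For a
form `F` of degree `μ` in the quasi-regular sequence `c ⊆ 𝔪` (a hypersurface `f = F(c) ∈ P^μ`), a point
`π : B_j → κ` of the chart `B_j = R[P/c_j]` over the closed point (`π(φ 𝔪) = 0`) at which the weak transform `F(e)` has
order `≥ μ` (`∃ s, π s ≠ 0 ∧ s·F(e) ∈ (ker π)^μ`), the reduction `F̄ ⊗ κ ∈ κ[T_1, …, T_k]` of `F` is a form `G` of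
degree `μ` in the linear forms `T_l − π(e_l)·T_j`, `l ≠ j` (`G` free of `T_j`):
`F ⊗ κ = G(T_l − π(e_l) T_j)`. [folklore] -/
theorem exists_form_eq_aeval_of_near_chart (hcq : IsQuasiRegular c) (hcm : ∀ l, c l ∈ maximalIdeal R)
    {F : MvPolynomial (Fin k) R} {μ : ℕ} (hF : F.IsHomogeneous μ)
    {κ : Type w} [Field κ] (π : chartRing c j →+* κ) (hπ : ∀ r ∈ maximalIdeal R, π (chartBase c j r) = 0)
    (hnear : ∃ s, π s ≠ 0 ∧
      s * MvPolynomial.eval₂Hom (chartBase c j) (fun l => chartGen c j l) F ∈ RingHom.ker π ^ μ) :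
    ∃ G : MvPolynomial (Fin k) κ, G.IsHomogeneous μ ∧ fibreRestrict κ Set.univ j G = G ∧
      MvPolynomial.map (π.comp (chartBase c j)) F =
        aeval (fun l => X l - C (π (chartGen c j l)) * X j) G := by
  classical
  letI : Field (R ⧸ maximalIdeal R) := Ideal.Quotient.field _
  obtain ⟨ρ, hρsurj, hρker, hρF⟩ := exists_chartResidueMap c j hcq hcm
  -- `π` factors through `ρ`
  have hkerle : RingHom.ker ρ ≤ RingHom.ker π := by
    rw [hρker, Ideal.map_le_iff_le_comap]
    intro r hr
    rw [Ideal.mem_comap, RingHom.mem_ker]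
    exact hπ r hr
  obtain ⟨π', hπ'⟩ : ∃ π' : MvPolynomial {l : Fin k // l ≠ j} (R ⧸ maximalIdeal R) →+* κ,
      ∀ b, π' (ρ b) = π b :=
    ⟨(ρ.liftOfSurjective hρsurj) ⟨π, hkerle⟩,
      fun b => ρ.liftOfSurjective_comp_apply hρsurj ⟨π, hkerle⟩ b⟩
  -- `ρ` on generators and constants
  have hρe : ∀ l (hl : l ≠ j), ρ (chartGen c j l) = X ⟨l, hl⟩ := by
    intro l hl
    have h := hρF (X l)
    rw [MvPolynomial.coe_eval₂Hom, MvPolynomial.eval₂_X] at h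
    rw [h]
    change MvPolynomial.map _ (aeval (killVar j) (X l)) = _
    rw [aeval_X, killVar_of_ne j hl, map_X]
  have hρC : ∀ r : R, ρ (chartBase c j r) = C (Ideal.Quotient.mk (maximalIdeal R) r) := by
    intro r
    have h := hρF (C r)
    rw [MvPolynomial.coe_eval₂Hom, MvPolynomial.eval₂_C] at h
    rw [h]
    change MvPolynomial.map _ (aeval (killVar j) (C r)) = _
    rw [algHom_C, MvPolynomial.algebraMap_eq, map_C]
  -- the residue field `K = R/𝔪` as a subfield of `κ`
  let ι : (R ⧸ maximalIdeal R) →+* κ := π'.comp MvPolynomial.C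
  letI : Algebra (R ⧸ maximalIdeal R) κ := ι.toAlgebra
  have hιmk : ∀ r : R, ι (Ideal.Quotient.mk (maximalIdeal R) r) = π (chartBase c j r) := by
    intro r
    change π' (C (Ideal.Quotient.mk (maximalIdeal R) r)) = _
    rw [← hρC, hπ']
  -- the point of `K[X_{Fin k}]`: `X_l ↦ π e_l` (`l ≠ j`), `X_j ↦ 0`
  let Pt : MvPolynomial (Fin k) (R ⧸ maximalIdeal R) →ₐ[R ⧸ maximalIdeal R] κ :=
    aeval fun l => if l = j then 0 else π (chartGen c j l)
  have hPtj : Pt (X j) = 0 := by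
    change aeval _ (X j) = 0
    rw [aeval_X, if_pos rfl]
  have hPtX : ∀ l, l ≠ j → Pt (X l) = π (chartGen c j l) := by
    intro l hl
    change aeval _ (X l) = _
    rw [aeval_X, if_neg hl]
  -- `Pt ∘ (rename val) = π'`
  have hPtval : ∀ a, Pt (rename (Subtype.val : {l : Fin k // l ≠ j} → Fin k) a) = π' a := by
    intro a
    have h : (Pt : MvPolynomial (Fin k) (R ⧸ maximalIdeal R) →+* κ).comp
        (rename (Subtype.val : {l : Fin k // l ≠ j} → Fin k)).toRingHom = π' := by
      refine MvPolynomial.ringHom_ext (fun a => ?_) (fun l => ?_)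
      · simp only [RingHom.comp_apply, AlgHom.toRingHom_eq_coe, RingHom.coe_coe, algHom_C, AlgHom.commutes]
        rfl
      · simp only [RingHom.comp_apply, AlgHom.toRingHom_eq_coe, RingHom.coe_coe, rename_X]
        rw [hPtX l.1 l.2, ← hπ' (chartGen c j l.1), hρe l.1 l.2]
    exact RingHom.congr_fun h a
  -- the near condition, transported to `K[X_{Fin k}]`
  set Fbar := MvPolynomial.map (Ideal.Quotient.mk (maximalIdeal R)) F with hFbar
  have hnear' : ∃ s, Pt s ≠ 0 ∧ s * dehomog (R ⧸ maximalIdeal R) j Fbar ∈ RingHom.ker Pt ^ μ := by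
    obtain ⟨s, hs, hsF⟩ := hnear
    let θ : chartRing c j →+* MvPolynomial (Fin k) (R ⧸ maximalIdeal R) :=
      (rename (Subtype.val : {l : Fin k // l ≠ j} → Fin k)).toRingHom.comp ρ
    have hθ : ∀ b, θ b = rename (Subtype.val : {l : Fin k // l ≠ j} → Fin k) (ρ b) := fun b => rfl
    have hθle : (RingHom.ker π).map θ ≤ RingHom.ker Pt := by
      rw [Ideal.map_le_iff_le_comap]
      intro b hb
      rw [Ideal.mem_comap, RingHom.mem_ker, hθ, hPtval, hπ']
      exact hb
    refine ⟨θ s, ?_, ?_⟩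
    · rw [hθ, hPtval, hπ']
      exact hs
    · have hFe : θ (MvPolynomial.eval₂Hom (chartBase c j) (fun l => chartGen c j l) F) =
          dehomog (R ⧸ maximalIdeal R) j Fbar := by
        rw [hθ, hρF, map_dehomogenize, rename_dehomogenize]
      rw [← hFe, ← map_mul]
      have hm := Ideal.mem_map_of_mem θ hsF
      rw [Ideal.map_pow] at hm
      exact Ideal.pow_right_mono hθle μ hm
  -- apply the polynomial structure theorem over `K`
  obtain ⟨G, hG, hGfix, hFG⟩ := exists_form_eq_aeval_of_dehomog_mem_pow (A := Set.univ) (hF.map _)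
    (fibreRestrict_univ_dehomog (R ⧸ maximalIdeal R) j Fbar) Pt hPtj (fun i hi => absurd (Set.mem_univ i) hi) hnear'
  refine ⟨G, hG, hGfix, ?_⟩
  have hcomp : (algebraMap (R ⧸ maximalIdeal R) κ).comp (Ideal.Quotient.mk (maximalIdeal R)) =
      π.comp (chartBase c j) :=
    RingHom.ext fun r => hιmk r
  have hmap : MvPolynomial.map (π.comp (chartBase c j)) F = MvPolynomial.map (algebraMap _ κ) Fbar := by
    rw [hFbar, map_map, hcomp]
  rw [hmap, hFG]
  refine aeval_congr_of_fibreRestrict_eq κ Set.univ j hGfix fun l _ hl => ?_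
  rw [hPtX l hl]

/-- **TRANSLATION INVARIANCE AT A NEAR POINT** (chart of a blowing up of a local ring along a quasi-regular centre):
under the hypotheses of `exists_form_eq_aeval_of_near_chart`, `F ⊗ κ` is invariant under translation by the direction
`v = (π e_l)_l` of the point (`v_j = π e_j = 1`). [folklore] -/
theorem shift_map_eq_of_near_chart (hcq : IsQuasiRegular c) (hcm : ∀ l, c l ∈ maximalIdeal R)
    {F : MvPolynomial (Fin k) R} {μ : ℕ} (hF : F.IsHomogeneous μ)
    {κ : Type w} [Field κ] (π : chartRing c j →+* κ) (hπ : ∀ r ∈ maximalIdeal R, π (chartBase c j r) = 0)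
    (hnear : ∃ s, π s ≠ 0 ∧
      s * MvPolynomial.eval₂Hom (chartBase c j) (fun l => chartGen c j l) F ∈ RingHom.ker π ^ μ) :
    shift (fun l => π (chartGen c j l)) (MvPolynomial.map (π.comp (chartBase c j)) F) =
      MvPolynomial.map (π.comp (chartBase c j)) F := by
  obtain ⟨G, -, hGfix, hFG⟩ := exists_form_eq_aeval_of_near_chart c j hcq hcm hF π hπ hnear
  have hj : π (chartGen c j j) = 1 := by
    have h1 : chartGen c j j = 1 := chartGen_self c j
    rw [h1, map_one]
  rw [hFG, ← AlgHom.comp_apply, comp_aeval]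
  refine aeval_congr_of_fibreRestrict_eq κ Set.univ j hGfix fun l _ hl => ?_
  simp only [map_sub, map_mul, shift_X, algHom_C, MvPolynomial.algebraMap_eq, hj, map_one]
  ring

/-- **RIDGE CONFINEMENT OF NEAR POINTS — HYPERSURFACES IN A LOCAL RING, EVERY CHARACTERISTIC** [OURS · L1 W4.2; the
chart-algebra form of the hypersurface instance of the informal crux `RidgeConfinement`, stmt-17845; NOT a statement of
the manuscript]. For `(R, 𝔪, k)` local, `c ⊆ 𝔪` quasi-regular (centre `P = (c)`), a form `F` of degree `μ` over `R`
(hypersurface `f = F(c) ∈ P^μ`, initial form `F̄ = F mod 𝔪` on the normal space `N_x = Spec k[T_1, …, T_k]`), and a point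
`π : B_j → κ` of the `j`-chart over the closed point at which the weak transform `F(e)` has order `≥ μ` (NEAR): the
direction `v = (π e_l)_l` is a `κ`-point of Giraud's ridge of the cone `V(F̄) ⊆ N_x`, for the `k`-algebra structure
`k → κ` induced by `π ∘ φ` — `x' ∈ ℙ(F(C_x X)/T_x D)(κ)`, with no hypothesis on the characteristic or on the residue
field extension. [folklore] -/
theorem chartGen_mem_ridge_of_near (hcq : IsQuasiRegular c) (hcm : ∀ l, c l ∈ maximalIdeal R)
    {F : MvPolynomial (Fin k) R} {μ : ℕ} (hF : F.IsHomogeneous μ)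
    {κ : Type w} [Field κ] (π : chartRing c j →+* κ) (hπ : ∀ r ∈ maximalIdeal R, (π.comp (chartBase c j)) r = 0)
    (hnear : ∃ s, π s ≠ 0 ∧
      s * MvPolynomial.eval₂Hom (chartBase c j) (fun l => chartGen c j l) F ∈ RingHom.ker π ^ μ) :
    letI : Algebra (ResidueField R) κ := (Ideal.Quotient.lift (maximalIdeal R) (π.comp (chartBase c j)) hπ).toAlgebra
    (fun l => π (chartGen c j l)) ∈ ridge κ (Ideal.span {MvPolynomial.map (residue R) F}) := by
  letI : Algebra (ResidueField R) κ := (Ideal.Quotient.lift (maximalIdeal R) (π.comp (chartBase c j)) hπ).toAlgebra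
  have hmap : MvPolynomial.map (algebraMap (ResidueField R) κ) (MvPolynomial.map (residue R) F) =
      MvPolynomial.map (π.comp (chartBase c j)) F := by
    rw [map_map]
    rfl
  refine mem_ridge_span_singleton_of_shift_map_eq ?_
  rw [hmap]
  exact shift_map_eq_of_near_chart c j hcq hcm hF π hπ hnear

/-- A prime `𝔴` of the chart ring lying over the closed point gives a point `B_j → κ(𝔴)` killing `φ(𝔪)`. [folklore] -/
theorem algebraMap_residueField_chartBase_eq_zero (𝔴 : Ideal (chartRing c j)) [𝔴.IsPrime]
    (h𝔴 : (maximalIdeal R).map (chartBase c j) ≤ 𝔴) :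
    ∀ r ∈ maximalIdeal R,
      ((algebraMap (chartRing c j) (Ideal.ResidueField 𝔴)).comp (chartBase c j)) r = 0 := by
  intro r hr
  rw [RingHom.comp_apply, Ideal.algebraMap_residueField_eq_zero]
  exact h𝔴 (Ideal.mem_map_of_mem _ hr)

/-- The same at every SCHEME POINT of the chart over the closed point: for a prime `𝔴 ⊇ 𝔪 B_j` of the chart ring
with residue field `κ(𝔴)` (`hπ` from `algebraMap_residueField_chartBase_eq_zero`) and `F(e) ∈ 𝔴^μ (B_j)_𝔴`
(`∃ s ∉ 𝔴, s·F(e) ∈ 𝔴^μ`, NEAR), the tautological direction `(ē_l)_l ∈ κ(𝔴)^k` lies in Giraud's ridge of `V(F̄)`.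
[folklore] -/
theorem residue_chartGen_mem_ridge_of_near (hcq : IsQuasiRegular c) (hcm : ∀ l, c l ∈ maximalIdeal R)
    {F : MvPolynomial (Fin k) R} {μ : ℕ} (hF : F.IsHomogeneous μ)
    (𝔴 : Ideal (chartRing c j)) [𝔴.IsPrime]
    (hπ : ∀ r ∈ maximalIdeal R,
      ((algebraMap (chartRing c j) (Ideal.ResidueField 𝔴)).comp (chartBase c j)) r = 0)
    (hnear : ∃ s ∉ 𝔴, s * MvPolynomial.eval₂Hom (chartBase c j) (fun l => chartGen c j l) F ∈ 𝔴 ^ μ) :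
    letI : Algebra (ResidueField R) (Ideal.ResidueField 𝔴) :=
      (Ideal.Quotient.lift (maximalIdeal R)
        ((algebraMap (chartRing c j) (Ideal.ResidueField 𝔴)).comp (chartBase c j)) hπ).toAlgebra
    (fun l : Fin k => (algebraMap (chartRing c j) (Ideal.ResidueField 𝔴) : chartRing c j →+* Ideal.ResidueField 𝔴)
        (chartGen c j l)) ∈
      ridge (Ideal.ResidueField 𝔴) (Ideal.span {MvPolynomial.map (residue R) F}) := by
  refine chartGen_mem_ridge_of_near c j hcq hcm hF
    (algebraMap (chartRing c j) (Ideal.ResidueField 𝔴) : chartRing c j →+* Ideal.ResidueField 𝔴) hπ ?_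
  obtain ⟨s, hs, h⟩ := hnear
  refine ⟨s, ?_, ?_⟩
  · rw [Ne, Ideal.algebraMap_residueField_eq_zero]
    exact hs
  · rw [Ideal.ker_algebraMap_residueField]
    exact h

end LocalRing

end CampaignW42

end Summit.ResolutionOfSingularities.ResolutionOfSingularities.Theorems

end
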